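import Summits.HodgeConjecture.HodgeConjecture.Theorems.F0P3XiLocalFamilyOfRecord
import Summits.HodgeConjecture.HodgeConjecture.Theorems.F0P3XiUnramSplitInstance
import Literature.NumberTheory.Automorphic.LocalUnitaryIntegralLevelCongr
import Literature.NumberTheory.GaloisRepresentations.HeckeCharacterRamificationProofs
import HarnessLib

/-!
# THE ξ-LOCAL FAMILY OF RECORD `packFin₀ ξ` of the T5 kit `𝔠₀` (II): law `XiUnram` — its unramified member is admissible and `K_v`-spherical with its
# eigencharacter off a FINITE set `ramOfRecord ξ` (Rogawski §12.2, §13.1, §13.7; Tate's Lemma 3.2.1)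

Cell `hodgecm-mathlib`, F0∕P3 «U3-mult», crux H413 (`stmt-HodgeConjecture-24833`), rung 4, PLAN.F0P3g4 §24 Z7 (β) ∕ ADDENDUM 1 §28.3 ∕ RULING (V24)(c)
(F0P3-p01 (g7)).  DEF LANE: ONE definition (`ramOfRecord`) + theorems; no instance, no notation, no named fact, no `sorry`.  Part (I) =
`Theorems/F0P3XiLocalFamilyOfRecord.lean` (`xiFamilyOfRecord`, law `xiFamilyFin`).  At ED. 4: `ram₀ ξ ⊇ ramOfRecord … ξ`, `tXi₀ ξ v :=` the normalised class
character of `(packFin₀ ξ v).πn`, law `xiUnram` ((V11)(ii)) := `xiUnram_xiFamilyOfRecord` — UNCONDITIONAL.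

CONTENTS.
* §1 `eventually_forall_apply_localUnits_eq_one` — Tate's Lemma 3.2.1 for a continuous character of a SUBGROUP `T ≤ 𝕀_K` (★ `tendsto_localUnits_integer` +
  ★ `eq_one_of_norm_pow_sub_one_le`): `η` is trivial on `T ∩ ⟨𝒪_wˣ⟩_w` for a.e. `w`.
* §2 non-split bridges to ★ p817292 ∕ p817760's `Valued.v` hypotheses: (B1) `semilocalComponent_eq_one_of_forall_isUnramifiedAt` (`μ_v` from `μ.IsUnramifiedAt w`,
  `w ∣ v`); (B2) `valued_apply_eq_one_of_mem_normOneUnits`, `coe_locTorusIncl_eq_localUnits`, **`eventually_torusLocalComponent_eq_one`** — at a.e. NON-SPLIT `v`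
  the local component `η_v` of a continuous character `η` of the adelic norm-one torus IS TRIVIAL (`T(L⁺_v)` is compact, cf. ★ `torusLocalComponent_eq_one_of_spherical`).
* §3 `isAdmissible_isSpherical_πn_xiFamilyOfRecord_of_nonsplit ∕ _of_split ∕ _of_good`, `xiUnram_xiFamilyOfRecord_of_good` (pin-(ii) currency ★
  `IrrClass.IsSphericalWith K_v μ (μ(K_v)⁻¹ tr πⁿ)` for any Haar `μ`; split side ★ p817781, non-split side ★ p817760 + ★ p818229).
* §4 `finite_setOf_not_good`; the definition **`ramOfRecord ξ : Finset`**; `good_of_not_mem_ramOfRecord`; **`xiUnram_xiFamilyOfRecord (hv : v ∉ ramOfRecord ξ)`**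
  and `eventually_xiUnram_xiFamilyOfRecord`.

References: [Rogawski1990] §4.5 p. 45, §12.2 pp. 173–174, §13.1 p. 199, §13.7 p. 206, §14.2 pp. 232–233; [CartierCorvallis1979] §III.3, §IV.1 Thm. 4.1 ∕ Cor. 4.1;
[TateThesis1967] §2.3, Lemma 3.2.1, §4.3; [PlatonovRapinchuk1994] §5.1, §6.2; [Jacobowitz1962] Thm. 3.1; [CasselsFrohlichANT1967] Ch. VII Prop. 1.2.
HC_CM is proved only modulo the printed citations until rung 0 closes.
-/

set_option autoImplicit false
set_option linter.dupNamespace false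

noncomputable section

open NumberField IsDedekindDomain MeasureTheory Filter Topology
open scoped Matrix MatrixGroups

namespace Summit.HodgeConjecture.HodgeConjecture.Cruxes.H413.F0P3XiLocalFamilyOfRecord

open Literature.NumberTheory Literature.NumberTheory.Automorphic Literature.NumberTheory.Automorphic.UnitaryGroup
open Literature.NumberTheory.Rogawski1990 Literature.NumberTheory.GaloisRepresentations
open Literature.NumberTheory.Automorphic.Arthur2013.Leaves.TECR

/-! ## §1 Tate's Lemma 3.2.1 for a continuous character of a SUBGROUP of the ideles -/

section Tate

variable {K : Type} [Field K] [NumberField K]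

/-- **A continuous character of a subgroup `T ≤ 𝕀_K` is trivial on `T ∩ ⟨𝒪_wˣ⟩_w` for all but finitely many `w`** (Tate's Lemma 3.2.1 for
the restricted product, read on a subgroup with the subspace topology: a neighbourhood of `1` in `ℂˣ` containing no subgroup but `{1}`
(★ `HeckeCharacter.eq_one_of_norm_pow_sub_one_le`), a neighbourhood `N` of `1` in `𝕀_K` with `η(T ∩ N)` inside it, and `⟨𝒪_wˣ⟩_w ⊆ N` for
almost every `w` (★ `HeckeCharacter.tendsto_localUnits_integer`)). [cite: TateThesis1967, Lemma 3.2.1] -/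
theorem eventually_forall_apply_localUnits_eq_one (T : Subgroup (ideleGroup K)) (η : ↥T →ₜ* ℂˣ) :
    ∀ᶠ w : HeightOneSpectrum (𝓞 K) in cofinite, ∀ (u : (w.adicCompletionIntegers K)ˣ)
      (ht : localUnits w (Units.map ((w.adicCompletionIntegers K).subtype : _ →* _) u) ∈ T), η ⟨_, ht⟩ = 1 := by
  have hV : {x : ℂˣ | ‖(x : ℂ) - 1‖ < 1 / 2} ∈ 𝓝 (1 : ℂˣ) := by
    have hc : Continuous fun x : ℂˣ => ‖(x : ℂ) - 1‖ := by fun_prop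
    exact (isOpen_lt hc continuous_const).mem_nhds (by simp)
  have hη : η ⁻¹' {x : ℂˣ | ‖(x : ℂ) - 1‖ < 1 / 2} ∈ 𝓝 (1 : ↥T) :=
    (map_continuous η).continuousAt.preimage_mem_nhds (by rwa [map_one])
  rw [nhds_subtype_eq_comap] at hη
  obtain ⟨N, hN, hNsub⟩ := hη
  obtain ⟨C, hC, hCsub⟩ := Filter.mem_comap.mp (HeckeCharacter.tendsto_localUnits_integer K hN)
  filter_upwards [hC] with w hw u ht
  rw [← Units.val_eq_one]
  refine HeckeCharacter.eq_one_of_norm_pow_sub_one_le (c := 1 / 2) (by norm_num) fun n => ?_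
  have htn : localUnits w (Units.map ((w.adicCompletionIntegers K).subtype : _ →* _) (u ^ n)) ∈ T := by
    rw [map_pow, map_pow]; exact T.pow_mem ht n
  have hmem : (⟨_, htn⟩ : ↥T) ∈ Subtype.val ⁻¹' N :=
    hCsub (show (⟨w, u ^ n⟩ : Σ v : HeightOneSpectrum (𝓞 K), (v.adicCompletionIntegers K)ˣ) ∈ Sigma.fst ⁻¹' C from hw)
  have hin := hNsub hmem
  have heq : (⟨_, htn⟩ : ↥T) = ⟨_, ht⟩ ^ n := by
    apply Subtype.ext
    show localUnits w (Units.map ((w.adicCompletionIntegers K).subtype : _ →* _) (u ^ n)) =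
      (localUnits w (Units.map ((w.adicCompletionIntegers K).subtype : _ →* _) u)) ^ n
    rw [map_pow, map_pow]
  rw [heq, Set.mem_preimage, map_pow, Set.mem_setOf_eq, Units.val_pow_eq_pow_val] at hin
  exact hin.le

end Tate

/-! ## §2 Non-split local bridges: the unramified hypotheses of ★ p817292 ∕ p817760 from Hecke-character data -/

section NonsplitBridges

variable (L : Type) [Field L] [NumberField L] [IsCMField L] (v : HeightOneSpectrum (𝓞 ↥(maximalRealSubfield L)))

omit [IsCMField L] in
/-- **(B1) `μ_v` is unramified when `μ` is unramified at every `w ∣ v`**: the semi-local component `μ_v = ∏_{w ∣ v} μ_w` (★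
`semilocalComponent_eq_prod`) is trivial on the units all of whose `w`-components have valuation `1` (★
`IsUnramifiedAt.localComponent_eq_one_of_valuation_eq_one`, valuations bridged by ★ `v_eq_one_iff_valuation_eq_one`). [cite: TateThesis1967, §4.3] -/
theorem semilocalComponent_eq_one_of_forall_isUnramifiedAt (μω : HeckeCharacter L)
    (hμ : ∀ w : PlacesOver L v, μω.IsUnramifiedAt w.1) (u : (LocalRing L v)ˣ)
    (hu : ∀ w : PlacesOver L v, Valued.v ((u : LocalRing L v) w) = 1) :
    μω.semilocalComponent L v u = 1 := by
  rw [semilocalComponent_eq_prod]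
  refine Finset.prod_eq_one fun w _ => (hμ w).localComponent_eq_one_of_valuation_eq_one ?_
  rw [← v_eq_one_iff_valuation_eq_one]
  exact hu w

/-- **(B2a) At a NON-SPLIT place every norm-one semi-local unit has valuation-`1` components** (`ū·u = 1` and `c` preserves the valuation
at the unique place above `v`). [cite: Rogawski1990, §12.2 p. 173] [cite: CasselsFrohlichANT1967, Ch. VII Prop. 1.2 (ii)] -/
theorem valued_apply_eq_one_of_mem_normOneUnits (hns : ∀ w : PlacesOver L v, IsCMField.complexConj L • w.1 = w.1)
    {u : (LocalRing L v)ˣ} (hu : u ∈ normOneUnits (conjLocal L (IsCMField.complexConj L) v)) (w : PlacesOver L v) :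
    Valued.v ((u : LocalRing L v) w) = 1 := by
  haveI := PlacesOver.subsingleton_of_smul_eq (IsCMField.complexConj L) (IsCMField.complexConj_ne_one L) w (hns w)
  have h1 : Units.map (conjLocal L (IsCMField.complexConj L) v : LocalRing L v →* LocalRing L v) u * u = 1 := hu
  have h2 : conjLocal L (IsCMField.complexConj L) v (u : LocalRing L v) w * (u : LocalRing L v) w = 1 := by
    have := congrArg (fun x : (LocalRing L v)ˣ => (x : LocalRing L v) w) h1
    simpa only [Units.val_mul, Units.coe_map, MonoidHom.coe_coe, Pi.mul_apply, Units.val_one, Pi.one_apply] using this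
  have h3 : Valued.v ((u : LocalRing L v) w) * Valued.v ((u : LocalRing L v) w) = 1 := by
    have h4 := congrArg Valued.v h2
    rw [map_mul, map_one, v_conjLocal_apply L v, Subsingleton.elim (⟨_, under_inv_smul_eq (IsCMField.complexConj L) w⟩ : PlacesOver L v) w] at h4
    exact h4
  rcases le_total (Valued.v ((u : LocalRing L v) w)) 1 with h | h
  · exact le_antisymm h (by simpa only [h3, mul_one] using mul_le_mul' (le_refl (Valued.v ((u : LocalRing L v) w))) h)
  · exact le_antisymm (by simpa only [h3, mul_one] using mul_le_mul' (le_refl (Valued.v ((u : LocalRing L v) w))) h) h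

/-- **(B2b) The idele of a local torus element at a non-split place is ONE local unit**: `locTorusIncl v t = ⟨t_w⟩_w` for the unique `w ∣ v`.
[cite: PlatonovRapinchuk1994, §6.2] -/
theorem coe_locTorusIncl_eq_localUnits (w : PlacesOver L v) (hw : IsCMField.complexConj L • w.1 = w.1)
    (t : ↥(normOneUnits (conjLocal L (IsCMField.complexConj L) v))) :
    ((locTorusIncl L (IsCMField.complexConj L) v t : ↥(TorusDict.torus (IsCMField.complexConj L))) : ideleGroup L) =
      localUnits w.1 (MulEquiv.piUnits (t : (LocalRing L v)ˣ) w) := by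
  rw [coe_locTorusIncl, semilocalUnits_apply,
    PlacesOver.prod_eq_of_smul_eq (IsCMField.complexConj L) (IsCMField.complexConj_ne_one L) w hw]

/-- **(B2) THE LOCAL TORUS CHARACTER IS TRIVIAL at all but finitely many NON-SPLIT places**: for a continuous character `η` of the adelic
norm-one torus `T(𝔸_{L⁺}) ≤ 𝕀_L`, `η_v = torusLocalComponent v η = 1` identically for a.e. non-split `v` — there `T(L⁺_v)` is compact, every
`t ∈ T(L⁺_v)` has valuation-`1` components (B2a), its idele is one local unit (B2b), and §1 applies. (The honest reading of «`ξ_v` unramified» at a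
non-split place; cf. ★ `torusLocalComponent_eq_one_of_spherical`.) [cite: Rogawski1990, §12.2 pp. 173–174] [cite: TateThesis1967, Lemma 3.2.1] -/
theorem eventually_torusLocalComponent_eq_one (η : ↥(TorusDict.torus (IsCMField.complexConj L)) →ₜ* ℂˣ) :
    ∀ᶠ v : HeightOneSpectrum (𝓞 ↥(maximalRealSubfield L)) in cofinite,
      (∀ w : PlacesOver L v, IsCMField.complexConj L • w.1 = w.1) →
        ∀ t : ↥(normOneUnits (conjLocal L (IsCMField.complexConj L) v)), torusLocalComponent L (IsCMField.complexConj L) v η t = 1 := by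
  filter_upwards [eventually_forall_placesOver (F := ↥(maximalRealSubfield L)) L (eventually_forall_apply_localUnits_eq_one _ η)]
    with v hv hns t
  obtain ⟨w⟩ : Nonempty (PlacesOver L v) := inferInstance
  -- the `w`-component of `t` is a unit of `𝒪_w`
  have hval : ValuativeRel.valuation (w.1.adicCompletion L) ((MulEquiv.piUnits (t : (LocalRing L v)ˣ) w : (w.1.adicCompletion L)ˣ) :
      w.1.adicCompletion L) = 1 := by
    rw [← v_eq_one_iff_valuation_eq_one]
    exact valued_apply_eq_one_of_mem_normOneUnits L v hns t.2 w
  obtain ⟨u, hu⟩ := HeckeCharacter.exists_units_map_subtype_eq_of_valuation_eq_one w.1 hval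
  have hidele : ((locTorusIncl L (IsCMField.complexConj L) v t : ↥(TorusDict.torus (IsCMField.complexConj L))) : ideleGroup L) =
      localUnits w.1 (Units.map ((w.1.adicCompletionIntegers L).subtype : _ →* _) u) := by
    rw [coe_locTorusIncl_eq_localUnits L v w (hns w), hu]
  have ht : localUnits w.1 (Units.map ((w.1.adicCompletionIntegers L).subtype : _ →* _) u) ∈ TorusDict.torus (IsCMField.complexConj L) := by
    rw [← hidele]; exact (locTorusIncl L (IsCMField.complexConj L) v t).2
  rw [torusLocalComponent_apply]
  have heq : locTorusIncl L (IsCMField.complexConj L) v t = ⟨_, ht⟩ := Subtype.ext hidele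
  rw [heq]
  exact hv w u ht

end NonsplitBridges

/-! ## §3 The record's unramified member IS admissible and `K_v`-spherical at the good places (law `XiUnram` place by place) -/

section Unram

variable (L : Type) [Field L] [NumberField L] [IsCMField L] (H : Matrix (Fin 3) (Fin 3) L)
  (hH : (H.map (cmConjRingHom L))ᵀ = H) (hHd : IsUnit H.det) (μω : HeckeCharacter L) (hμu : μω.IsUnitary)

/-- **NON-SPLIT good place**: if a level-matching form congruence exists at `v`, `μ` is unramified above `v` and `η_v = ψ_v = 1`, then the record's
member `πⁿ` at `v` is ADMISSIBLE and `K_v`-SPHERICAL — it is the pull-back of THE spherical admissible constituent of `i_G(χ_ξ,v)` (★ p817760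
`exists_spherical_constituent`, hypotheses discharged by §2) along a level-matching congruence (★ p817760 `comap_isAdmissible_isSpherical`).
[cite: Rogawski1990, §12.2 pp. 173–174; §13.1 p. 199; §14.2 p. 233] [cite: CartierCorvallis1979, §IV.1] -/
theorem isAdmissible_isSpherical_πn_xiFamilyOfRecord_of_nonsplit (ξ : OneDimAutRepH L) (v : HeightOneSpectrum (𝓞 ↥(maximalRealSubfield L)))
    (hns : ∀ w : PlacesOver L v, IsCMField.complexConj L • w.1 = w.1)
    (hLM : (∃ (T : GL (Fin 3) (LocalRing L v)) (a : LocalRing L v) (ha : IsUnit a)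
          (h : formCongr (conjLocal L (IsCMField.complexConj L) v) T (H.map (algebraMap L (LocalRing L v))) =
            a • (Matrix.of fun i j : Fin 3 => if i.val + j.val + 1 = 3 then (1 : L) else 0).map (algebraMap L (LocalRing L v))),
          ∀ g : (cmDatum L 3 H).Local v, (cmDatumLocalCongr L v T ha h).symm g ∈ cmLocalIntegralLevel L 3 (qsForm L) v ↔
            g ∈ cmLocalIntegralLevel L 3 H v))
    (hμ : ∀ w : PlacesOver L v, μω.IsUnramifiedAt w.1)
    (hη : ∀ t, torusLocalComponent L (IsCMField.complexConj L) v ξ.η t = 1)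
    (hψ : ∀ t, torusLocalComponent L (IsCMField.complexConj L) v ξ.ψ t = 1) :
    (xiFamilyOfRecord L H hH hHd μω hμu ξ v).πn.IsAdmissible ∧
      (xiFamilyOfRecord L H hH hHd μω hμu ξ v).πn.IsSpherical (cmLocalIntegralLevel L 3 H v) := by
  -- THE spherical admissible constituent exists (★ p817760, hypotheses by §2)
  obtain ⟨r, hrc, hradm, hr1, -⟩ := F0P3XiUnramNonsplitInstance.exists_spherical_constituent L v (μω.semilocalComponent L v)
    (torusLocalComponent L (IsCMField.complexConj L) v ξ.η) (torusLocalComponent L (IsCMField.complexConj L) v ξ.ψ)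
    (semilocalComponent_eq_one_of_forall_isUnramifiedAt L v μω hμ) (fun t _ => hη t) (fun t _ => hψ t)
  have hsph : ∃ x' : IrrClass (Gqs L v), x'.IsConstituentOf (cmPrincipalSeries L 3 v (cmXiTorusChar L v (μω.semilocalComponent L v)
          (torusLocalComponent L (IsCMField.complexConj L) v ξ.η) (torusLocalComponent L (IsCMField.complexConj L) v ξ.ψ))) ∧
      x'.IsAdmissible ∧ x'.IsSpherical (cmLocalIntegralLevel L 3 (qsForm L) v) :=
    ⟨IrrClass.mk r, hrc, (IrrClass.isAdmissible_mk r).2 hradm, (IrrClass.isSpherical_mk r _).2 hr1⟩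
  obtain ⟨T, a, ha, h, x, hP, -, hT, hxs⟩ := (xiFamilyOfRecord_spec L H hH hHd μω hμu ξ v).2 hns
  obtain ⟨hadm, h1⟩ := hxs hsph
  rw [hP]
  exact F0P3XiUnramNonsplitInstance.comap_isAdmissible_isSpherical L v H (cmDatumLocalCongr L v T ha h).symm (hT hLM) hadm h1

/-- **SPLIT good place**: if `η̃, ψ̃, μ` are unramified at the fixed witness `w ∣ v` and `H_w ∈ GL₃(𝒪_w)`, the record's member at `v` — the D6 split
packet's `i_G(ξ_w)` — is ADMISSIBLE and `K_v`-SPHERICAL (★ p817781). [cite: Rogawski1990, §12.2 pp. 173–174; §13.1 p. 199] [cite: CartierCorvallis1979, §IV.1] -/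
theorem isAdmissible_isSpherical_πn_xiFamilyOfRecord_of_split (ξ : OneDimAutRepH L) (v : HeightOneSpectrum (𝓞 ↥(maximalRealSubfield L)))
    (hs : ∃ w : PlacesOver L v, IsCMField.complexConj L • w.1 ≠ w.1)
    (hη : ξ.bcη.IsUnramifiedAt (splitWitness v hs).1) (hψ : ξ.bcψ.IsUnramifiedAt (splitWitness v hs).1)
    (hμ : μω.IsUnramifiedAt (splitWitness v hs).1)
    (hHw : (isUnit_placeForm_of_isUnit_det hHd (splitWitness v hs).1).unit ∈ glInt 3 ((splitWitness v hs).1.adicCompletion L)) :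
    (xiFamilyOfRecord L H hH hHd μω hμu ξ v).πn.IsAdmissible ∧
      (xiFamilyOfRecord L H hH hHd μω hμu ξ v).πn.IsSpherical (cmLocalIntegralLevel L 3 H v) := by
  rw [xiFamilyOfRecord_of_split L H hH hHd μω hμu ξ v hs]
  exact ⟨F0P3XiUnramSplitInstance.isAdmissible_cmSplitPacket_πn L H hH hHd v _ _ _ _ _ _ _ _,
    F0P3XiUnramSplitInstance.isSpherical_cmSplitPacket_πn L H hH hHd v _ _ _ _ _ _ _ _
      (F0P3XiUnramSplitInstance.splitν₀_eq_one_of_isUnramifiedAt ξ μω hη hψ hμ)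
      (F0P3XiUnramSplitInstance.locψ_eq_one_of_isUnramifiedAt ξ hψ) hHw⟩

/-- **AT A GOOD PLACE (split or not) the record's member is admissible and `K_v`-spherical** — «good» = the conjunction defining `ramOfRecord` (§4).
[cite: Rogawski1990, §12.2 pp. 173–174; §13.1 p. 199] [cite: CartierCorvallis1979, §IV.1] -/
theorem isAdmissible_isSpherical_πn_xiFamilyOfRecord_of_good (ξ : OneDimAutRepH L) (v : HeightOneSpectrum (𝓞 ↥(maximalRealSubfield L)))
    (hgood : (∀ w : PlacesOver L v, ξ.bcη.IsUnramifiedAt w.1 ∧ ξ.bcψ.IsUnramifiedAt w.1 ∧ μω.IsUnramifiedAt w.1 ∧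
          (isUnit_placeForm_of_isUnit_det hHd w.1).unit ∈ glInt 3 (w.1.adicCompletion L)) ∧
        ((∀ w : PlacesOver L v, IsCMField.complexConj L • w.1 = w.1) →
          (∃ (T : GL (Fin 3) (LocalRing L v)) (a : LocalRing L v) (ha : IsUnit a)
          (h : formCongr (conjLocal L (IsCMField.complexConj L) v) T (H.map (algebraMap L (LocalRing L v))) =
            a • (Matrix.of fun i j : Fin 3 => if i.val + j.val + 1 = 3 then (1 : L) else 0).map (algebraMap L (LocalRing L v))),
          ∀ g : (cmDatum L 3 H).Local v, (cmDatumLocalCongr L v T ha h).symm g ∈ cmLocalIntegralLevel L 3 (qsForm L) v ↔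
            g ∈ cmLocalIntegralLevel L 3 H v) ∧
          (∀ t, torusLocalComponent L (IsCMField.complexConj L) v ξ.η t = 1) ∧
          (∀ t, torusLocalComponent L (IsCMField.complexConj L) v ξ.ψ t = 1))) :
    (xiFamilyOfRecord L H hH hHd μω hμu ξ v).πn.IsAdmissible ∧
      (xiFamilyOfRecord L H hH hHd μω hμu ξ v).πn.IsSpherical (cmLocalIntegralLevel L 3 H v) := by
  rcases Classical.em (∃ w : PlacesOver L v, IsCMField.complexConj L • w.1 ≠ w.1) with hs | hs
  · obtain ⟨hη, hψ, hμ, hHw⟩ := hgood.1 (splitWitness v hs)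
    exact isAdmissible_isSpherical_πn_xiFamilyOfRecord_of_split L H hH hHd μω hμu ξ v hs hη hψ hμ hHw
  · have hns : ∀ w : PlacesOver L v, IsCMField.complexConj L • w.1 = w.1 := fun w => not_not.1 fun hw => hs ⟨w, hw⟩
    obtain ⟨hLM, hη, hψ⟩ := hgood.2 hns
    exact isAdmissible_isSpherical_πn_xiFamilyOfRecord_of_nonsplit L H hH hHd μω hμu ξ v hns hLM (fun w => (hgood.1 w).2.2.1) hη hψ

/-- **The pin-(ii) currency**: at a good place, for any Haar measure `μ` on `G′_v`, the record's member is `K_v`-spherical WITH the eigencharacter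
`t_v = μ(K_v)⁻¹ tr πⁿ(·)` (★ D9 `IsSpherical.isSphericalWith_smoothTrace`) and admissible — the conjunction law `XiUnram` asks (RULING (V11)(ii)).
[cite: Rogawski1990, §13.7 p. 206; §12.2 pp. 173–174] [cite: CartierCorvallis1979, §IV.1 Cor. 4.1] -/
theorem xiUnram_xiFamilyOfRecord_of_good (ξ : OneDimAutRepH L) (v : HeightOneSpectrum (𝓞 ↥(maximalRealSubfield L)))
    [MeasurableSpace ((cmDatum L 3 H).Local v)] [BorelSpace ((cmDatum L 3 H).Local v)] (μ : Measure ((cmDatum L 3 H).Local v)) [μ.IsHaarMeasure]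
    (hgood : (∀ w : PlacesOver L v, ξ.bcη.IsUnramifiedAt w.1 ∧ ξ.bcψ.IsUnramifiedAt w.1 ∧ μω.IsUnramifiedAt w.1 ∧
          (isUnit_placeForm_of_isUnit_det hHd w.1).unit ∈ glInt 3 (w.1.adicCompletion L)) ∧
        ((∀ w : PlacesOver L v, IsCMField.complexConj L • w.1 = w.1) →
          (∃ (T : GL (Fin 3) (LocalRing L v)) (a : LocalRing L v) (ha : IsUnit a)
          (h : formCongr (conjLocal L (IsCMField.complexConj L) v) T (H.map (algebraMap L (LocalRing L v))) =
            a • (Matrix.of fun i j : Fin 3 => if i.val + j.val + 1 = 3 then (1 : L) else 0).map (algebraMap L (LocalRing L v))),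
          ∀ g : (cmDatum L 3 H).Local v, (cmDatumLocalCongr L v T ha h).symm g ∈ cmLocalIntegralLevel L 3 (qsForm L) v ↔
            g ∈ cmLocalIntegralLevel L 3 H v) ∧
          (∀ t, torusLocalComponent L (IsCMField.complexConj L) v ξ.η t = 1) ∧
          (∀ t, torusLocalComponent L (IsCMField.complexConj L) v ξ.ψ t = 1))) :
    (xiFamilyOfRecord L H hH hHd μω hμu ξ v).πn.IsSphericalWith (cmLocalIntegralLevel L 3 H v) μ (fun f =>
      (μ.real (cmLocalIntegralLevel L 3 H v : Set ((cmDatum L 3 H).Local v)) : ℂ)⁻¹ * (xiFamilyOfRecord L H hH hHd μω hμu ξ v).πn.smoothTrace μ f) ∧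
      (xiFamilyOfRecord L H hH hHd μω hμu ξ v).πn.IsAdmissible := by
  obtain ⟨hadm, h1⟩ := isAdmissible_isSpherical_πn_xiFamilyOfRecord_of_good L H hH hHd μω hμu ξ v hgood
  exact ⟨IrrClass.IsSpherical.isSphericalWith_smoothTrace μ hadm (isCompact_isOpen_cmLocalIntegralLevel L 3 H v).2
    (isCompact_isOpen_cmLocalIntegralLevel L 3 H v).1 (F0P3XiUnramSplitInstance.measureReal_cmLocalIntegralLevel_ne_zero L H v μ) h1, hadm⟩

end Unram

/-! ## §4 The finite exceptional set `ramOfRecord ξ` (the 𝔠₀ reading of `ram ξ`) and law `XiUnram` off it -/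

section Ram

variable (L : Type) [Field L] [NumberField L] [IsCMField L] (H : Matrix (Fin 3) (Fin 3) L)
  (hH : (H.map (cmConjRingHom L))ᵀ = H) (hHd : IsUnit H.det) (μω : HeckeCharacter L) (hμu : μω.IsUnitary)

include hH in
/-- **The good places are all but finitely many**: `η̃, ψ̃, μ` unramified above `v` and `H_w ∈ GL₃(𝒪_w)` (★ p817781 §4); at non-split `v` a
level-matching form congruence (★ p818229 `eventually_exists_cmDatumLocalCongr_levelMatching_three`, B-p08 (g19)) and `η_v = ψ_v = 1` (§2 (B2)).
[cite: TateThesis1967, Lemma 3.2.1] [cite: Rogawski1990, §12.2 p. 174; §14.2 p. 233] [cite: Jacobowitz1962, Thm. 3.1] -/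
theorem finite_setOf_not_good (ξ : OneDimAutRepH L) :
    {v : HeightOneSpectrum (𝓞 ↥(maximalRealSubfield L)) | ¬ ((∀ w : PlacesOver L v, ξ.bcη.IsUnramifiedAt w.1 ∧ ξ.bcψ.IsUnramifiedAt w.1 ∧ μω.IsUnramifiedAt w.1 ∧
          (isUnit_placeForm_of_isUnit_det hHd w.1).unit ∈ glInt 3 (w.1.adicCompletion L)) ∧
        ((∀ w : PlacesOver L v, IsCMField.complexConj L • w.1 = w.1) →
          (∃ (T : GL (Fin 3) (LocalRing L v)) (a : LocalRing L v) (ha : IsUnit a)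
          (h : formCongr (conjLocal L (IsCMField.complexConj L) v) T (H.map (algebraMap L (LocalRing L v))) =
            a • (Matrix.of fun i j : Fin 3 => if i.val + j.val + 1 = 3 then (1 : L) else 0).map (algebraMap L (LocalRing L v))),
          ∀ g : (cmDatum L 3 H).Local v, (cmDatumLocalCongr L v T ha h).symm g ∈ cmLocalIntegralLevel L 3 (qsForm L) v ↔
            g ∈ cmLocalIntegralLevel L 3 H v) ∧
          (∀ t, torusLocalComponent L (IsCMField.complexConj L) v ξ.η t = 1) ∧
          (∀ t, torusLocalComponent L (IsCMField.complexConj L) v ξ.ψ t = 1)))}.Finite := by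
  rw [← Filter.eventually_cofinite]
  filter_upwards [F0P3XiUnramSplitInstance.eventually_forall_placesOver_splitUnram (H := H) ξ μω hHd,
    eventually_exists_cmDatumLocalCongr_levelMatching_three L H hH hHd, eventually_torusLocalComponent_eq_one L ξ.η,
    eventually_torusLocalComponent_eq_one L ξ.ψ] with v h₁ h₂ h₃ h₄
  exact ⟨h₁, fun hns => ⟨h₂ hns, h₃ hns, h₄ hns⟩⟩

/-- **`ramOfRecord ξ` — THE FINITE EXCEPTIONAL SET OF THE RECORD** (the 𝔠₀ reading of `ram ξ`, PLAN.F0P3g4 ADDENDUM 1 §28.3): the places `v` of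
`L⁺` where one of «`η̃, ψ̃, μ` unramified above `v`», «`H_w ∈ GL₃(𝒪_w)`», or (non-split `v`) «a level-matching form congruence exists» ∕ «`η_v = ψ_v = 1`»
FAILS; finite by `finite_setOf_not_good`. [cite: Rogawski1990, §12.2 p. 174; §13.1 p. 199] [cite: TateThesis1967, Lemma 3.2.1] -/
def ramOfRecord (ξ : OneDimAutRepH L) : Finset (HeightOneSpectrum (𝓞 ↥(maximalRealSubfield L))) :=
  (finite_setOf_not_good L H hH hHd μω ξ).toFinset

/-- Off `ramOfRecord ξ` the place is good. [cite: Rogawski1990, §12.2 p. 174] -/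
theorem good_of_not_mem_ramOfRecord (ξ : OneDimAutRepH L) {v : HeightOneSpectrum (𝓞 ↥(maximalRealSubfield L))}
    (hv : v ∉ ramOfRecord L H hH hHd μω ξ) :
    (∀ w : PlacesOver L v, ξ.bcη.IsUnramifiedAt w.1 ∧ ξ.bcψ.IsUnramifiedAt w.1 ∧ μω.IsUnramifiedAt w.1 ∧
          (isUnit_placeForm_of_isUnit_det hHd w.1).unit ∈ glInt 3 (w.1.adicCompletion L)) ∧
        ((∀ w : PlacesOver L v, IsCMField.complexConj L • w.1 = w.1) →
          (∃ (T : GL (Fin 3) (LocalRing L v)) (a : LocalRing L v) (ha : IsUnit a)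
          (h : formCongr (conjLocal L (IsCMField.complexConj L) v) T (H.map (algebraMap L (LocalRing L v))) =
            a • (Matrix.of fun i j : Fin 3 => if i.val + j.val + 1 = 3 then (1 : L) else 0).map (algebraMap L (LocalRing L v))),
          ∀ g : (cmDatum L 3 H).Local v, (cmDatumLocalCongr L v T ha h).symm g ∈ cmLocalIntegralLevel L 3 (qsForm L) v ↔
            g ∈ cmLocalIntegralLevel L 3 H v) ∧
          (∀ t, torusLocalComponent L (IsCMField.complexConj L) v ξ.η t = 1) ∧
          (∀ t, torusLocalComponent L (IsCMField.complexConj L) v ξ.ψ t = 1)) := by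
  rw [ramOfRecord, Set.Finite.mem_toFinset, Set.mem_setOf_eq, not_not] at hv
  exact hv

/-- **LAW `XiUnram` AT 𝔠₀, OFF `ramOfRecord ξ`**: for `v ∉ ramOfRecord ξ` and any Haar measure on `G′_v`, the record's member `πⁿ` is `K_v`-spherical
WITH its eigencharacter and admissible (RULING (V11)(ii) ∕ (V24)(c): `packFin₀ := xiFamilyOfRecord`, `ram₀ ξ ⊇ ramOfRecord ξ`, `xiUnram := exact`).
[cite: Rogawski1990, §12.2 pp. 173–174; §13.1 p. 199; §13.7 p. 206] [cite: CartierCorvallis1979, §IV.1 Cor. 4.1] -/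
theorem xiUnram_xiFamilyOfRecord (ξ : OneDimAutRepH L) (v : HeightOneSpectrum (𝓞 ↥(maximalRealSubfield L)))
    (hv : v ∉ ramOfRecord L H hH hHd μω ξ)
    [MeasurableSpace ((cmDatum L 3 H).Local v)] [BorelSpace ((cmDatum L 3 H).Local v)] (μ : Measure ((cmDatum L 3 H).Local v)) [μ.IsHaarMeasure] :
    (xiFamilyOfRecord L H hH hHd μω hμu ξ v).πn.IsSphericalWith (cmLocalIntegralLevel L 3 H v) μ (fun f =>
      (μ.real (cmLocalIntegralLevel L 3 H v : Set ((cmDatum L 3 H).Local v)) : ℂ)⁻¹ * (xiFamilyOfRecord L H hH hHd μω hμu ξ v).πn.smoothTrace μ f) ∧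
      (xiFamilyOfRecord L H hH hHd μω hμu ξ v).πn.IsAdmissible :=
  xiUnram_xiFamilyOfRecord_of_good L H hH hHd μω hμu ξ v μ (good_of_not_mem_ramOfRecord L H hH hHd μω ξ hv)

/-- The same as an `∀ᶠ v in cofinite` statement for a family of Haar measures. [cite: Rogawski1990, §12.2 pp. 173–174; §13.7 p. 206] -/
theorem eventually_xiUnram_xiFamilyOfRecord (ξ : OneDimAutRepH L)
    [∀ v : HeightOneSpectrum (𝓞 ↥(maximalRealSubfield L)), MeasurableSpace ((cmDatum L 3 H).Local v)]
    [∀ v : HeightOneSpectrum (𝓞 ↥(maximalRealSubfield L)), BorelSpace ((cmDatum L 3 H).Local v)]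
    (μv : ∀ v : HeightOneSpectrum (𝓞 ↥(maximalRealSubfield L)), Measure ((cmDatum L 3 H).Local v)) [∀ v, (μv v).IsHaarMeasure] :
    ∀ᶠ v : HeightOneSpectrum (𝓞 ↥(maximalRealSubfield L)) in cofinite,
      (xiFamilyOfRecord L H hH hHd μω hμu ξ v).πn.IsSphericalWith (cmLocalIntegralLevel L 3 H v) (μv v) (fun f =>
        ((μv v).real (cmLocalIntegralLevel L 3 H v : Set ((cmDatum L 3 H).Local v)) : ℂ)⁻¹ *
          (xiFamilyOfRecord L H hH hHd μω hμu ξ v).πn.smoothTrace (μv v) f) ∧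
      (xiFamilyOfRecord L H hH hHd μω hμu ξ v).πn.IsAdmissible := by
  have h := (finite_setOf_not_good L H hH hHd μω ξ)
  rw [← Filter.eventually_cofinite] at h
  filter_upwards [h] with v hv
  exact xiUnram_xiFamilyOfRecord_of_good L H hH hHd μω hμu ξ v (μv v) hv

end Ram

end Summit.HodgeConjecture.HodgeConjecture.Cruxes.H413.F0P3XiLocalFamilyOfRecord

end
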